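import Literature.AnabelianGeometry.SemiGraphs.SgATemperedArrows
import Literature.AnabelianGeometry.SemiGraphs.TemperedVerticial
import Literature.AnabelianGeometry.SemiGraphs.CoverticialVertexCaseTools
import Literature.AnabelianGeometry.AbsoluteAnabelian.SlimTransport
import Mathlib.Topology.Homeomorph.Lemmas
import Mathlib.Tactic.Group
import HarnessLib

/-!
# Transport of the §2 hypotheses along isomorphisms of profinite presentations (route T, TRANSPORT I)

Mochizuki, *Semi-graphs of anabelioids*, Publ. RIMS **42** (2006), §2 Def. 2.1 p. 22 (injective
type), Def. 2.4 (ii)/(iv) pp. 25–26 (verticially slim, aloof, estranged), §1 p. 11 (connected,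
countable, graph), §3 Def. 3.5 (i) p. 37 [cite: MochizukiSemiAnbd2006, Def 2.4 pp.25-26].  For a
morphism of profinite presentations `F : X → Y` (`ProfiniteSemiGraph.Hom`) whose underlying morphism
of semi-graphs is an ISOMORPHISM and whose constituent homomorphisms are BIJECTIVE (`IsLocallyTrivial`)
— the data of an isomorphism over a base, `Hom.IsoOver` of `SgATemperedArrows` (abc-iut-L3-t3), with
the base forgotten — the §1–§2 hypotheses of Prop. 3.6 / Thm. 3.7 DESCEND from `Y` to `X`:

* underlying semi-graph: `SemiGraph.isConnected_of_isIso'`, `isCountable_of_isIso`, `isGraph_of_isIso`,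
  `nonempty_vertex_of_isIso` (through the inverse `inv F.base`);
* groups: `exists_continuousMulEquiv_of_bijective` (a bijective continuous homomorphism from a compact
  to a Hausdorff group is an isomorphism of topological groups), `Hom.exists_comm_castGe` (the
  compatibility 2-cell of `F` with the transport `castGe` in place of `▸`),
  `Hom.map_hV_branchSubgroup` (`hV(Π_b) = c · Π_{F b} · c⁻¹`);
* fields: `isOfInjectiveType_of_iso`, `isVerticiallySlim_of_iso`, `isTotallyAloof_of_iso`,
  `isTotallyEstranged_of_iso`.

The approximator-borne fields (quasi-coherent, totally elevated, strictly coherent) and the assembly are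
the sequel `ProfiniteSemiGraphIsoTransportApproximators`.  Proof-only (abc-iut cell, L3 route T ·
TRANSPORT; seat abc-iut-L3-d6); no definition; nothing here bears on [IUTchIII] Cor. 3.12.
-/

open CategoryTheory Topology

namespace Literature.AnabelianGeometry.SemiGraphs

universe u

/-! ### Isomorphisms of semi-graphs -/

namespace SemiGraph

variable {G G' : SemiGraph.{u}}

/-- `f⁻¹ (f v) = v` on vertices. [cite: MochizukiSemiAnbd2006, §1 p.11] -/
@[simp] theorem inv_vertexMap_vertexMap (f : G ⟶ G') [IsIso f] (v : G.Vertex) : (inv f).vertexMap (f.vertexMap v) = v := by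
  have h := congrArg Hom.vertexMap (IsIso.hom_inv_id f)
  exact congrFun h v

/-- `f (f⁻¹ w) = w` on vertices. [cite: MochizukiSemiAnbd2006, §1 p.11] -/
@[simp] theorem vertexMap_inv_vertexMap (f : G ⟶ G') [IsIso f] (w : G'.Vertex) : f.vertexMap ((inv f).vertexMap w) = w := by
  have h := congrArg Hom.vertexMap (IsIso.inv_hom_id f)
  exact congrFun h w

/-- `f⁻¹ (f e) = e` on edges. [cite: MochizukiSemiAnbd2006, §1 p.11] -/
@[simp] theorem inv_edgeMap_edgeMap (f : G ⟶ G') [IsIso f] (e : G.Edge) : (inv f).edgeMap (f.edgeMap e) = e := by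
  have h := congrArg Hom.edgeMap (IsIso.hom_inv_id f)
  exact congrFun h e

/-- `f (f⁻¹ e') = e'` on edges. [cite: MochizukiSemiAnbd2006, §1 p.11] -/
@[simp] theorem edgeMap_inv_edgeMap (f : G ⟶ G') [IsIso f] (e' : G'.Edge) : f.edgeMap ((inv f).edgeMap e') = e' := by
  have h := congrArg Hom.edgeMap (IsIso.inv_hom_id f)
  exact congrFun h e'

/-- `f⁻¹ (f b) = b` on branches. [cite: MochizukiSemiAnbd2006, §1 p.11] -/
@[simp] theorem inv_branchMap_branchMap (f : G ⟶ G') [IsIso f] (b : G.Branch) : (inv f).branchMap (f.branchMap b) = b := by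
  have h := congrArg Hom.branchMap (IsIso.hom_inv_id f)
  exact congrFun h b

/-- `f (f⁻¹ b') = b'` on branches. [cite: MochizukiSemiAnbd2006, §1 p.11] -/
@[simp] theorem branchMap_inv_branchMap (f : G ⟶ G') [IsIso f] (b' : G'.Branch) : f.branchMap ((inv f).branchMap b') = b' := by
  have h := congrArg Hom.branchMap (IsIso.inv_hom_id f)
  exact congrFun h b'

/-- An isomorphism of semi-graphs is injective on branches. [cite: MochizukiSemiAnbd2006, §1 p.11] -/
theorem branchMap_injective_of_isIso (f : G ⟶ G') [IsIso f] : Function.Injective f.branchMap := fun b₁ b₂ h => by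
  rw [← inv_branchMap_branchMap f b₁, h, inv_branchMap_branchMap]

/-- A semi-graph isomorphic to a connected one is connected (`isConnected_of_isIso` of
`CoverticialVertexCaseTools`, abc-iut-L6-t18, applied to the inverse).
[cite: MochizukiSemiAnbd2006, §1 pp.11-13] -/
theorem isConnected_of_isIso' (f : G ⟶ G') [IsIso f] (h : G'.IsConnected) : G.IsConnected :=
  isConnected_of_isIso (inv f) h

/-- Countability descends along an isomorphism. [cite: MochizukiSemiAnbd2006, §1 p.11] -/
theorem isCountable_of_isIso (f : G ⟶ G') [IsIso f] (h : G'.IsCountable) : G.IsCountable := by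
  haveI := h.countable_vertex
  haveI := h.countable_edge
  have hV : Function.Injective f.vertexMap := fun v₁ v₂ hv => by
    rw [← inv_vertexMap_vertexMap f v₁, hv, inv_vertexMap_vertexMap]
  have hE : Function.Injective f.edgeMap := fun e₁ e₂ he => by
    rw [← inv_edgeMap_edgeMap f e₁, he, inv_edgeMap_edgeMap]
  exact ⟨hV.countable, hE.countable⟩

/-- "Every branch abuts" descends along an isomorphism. [cite: MochizukiSemiAnbd2006, §1 p.11] -/
theorem isGraph_of_isIso (f : G ⟶ G') [IsIso f] (h : G'.IsGraph) : G.IsGraph := by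
  refine ⟨fun b => ?_⟩
  obtain ⟨w, hw⟩ := Option.isSome_iff_exists.mp (h.abuts_isSome (f.branchMap b))
  have := (inv f).abuts_branchMap (f.branchMap b) w hw
  rw [inv_branchMap_branchMap] at this
  rw [this]
  rfl

/-- A vertex pulls back along an isomorphism. [cite: MochizukiSemiAnbd2006, §1 p.11] -/
theorem nonempty_vertex_of_isIso (f : G ⟶ G') [IsIso f] (h : Nonempty G'.Vertex) : Nonempty G.Vertex :=
  h.map (inv f).vertexMap

end SemiGraph

namespace ProfiniteSemiGraph

open Literature.AlgebraicGeometry.Frobenioids (IsSlimGroup)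

variable {X Y : ProfiniteSemiGraph.{u}} (F : Hom X Y)

/-! ### Groups: bijective continuous homomorphisms of profinite groups; the 2-cell of `F` -/

/-- A bijective continuous homomorphism from a compact to a Hausdorff topological group is an
isomorphism of topological groups. [cite: MochizukiSemiAnbd2006, Def 2.2(ii) p.24] -/
theorem exists_continuousMulEquiv_of_bijective {A B : Type u} [Group A] [TopologicalSpace A]
    [CompactSpace A] [Group B] [TopologicalSpace B] [T2Space B] (f : A →ₜ* B)
    (hf : Function.Bijective f) : ∃ e : A ≃ₜ* B, ∀ a, e a = f a := by
  let h : A ≃ₜ B := Continuous.homeoOfEquivCompactToT2 (f := Equiv.ofBijective f hf) f.continuous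
  exact ⟨{ MulEquiv.ofBijective f.toMonoidHom hf with
      continuous_toFun := f.continuous
      continuous_invFun := h.symm.continuous }, fun _ => rfl⟩

/-- The transport `castGe` replaces the rewrite `▸` of `Hom.comm`. [cite: MochizukiSemiAnbd2006, Def. 2.1 p.23] -/
theorem eqRec_eq_castGe {e₁ e₂ : Y.graph.Edge} (h : e₁ = e₂) (y : Y.Ge e₂) :
    (h ▸ y : Y.Ge e₁) = Y.castGe h.symm y := by
  subst h; rfl

/-- The compatibility 2-cell of `F` at a branch, with the transport written as `castGe`.
[cite: MochizukiSemiAnbd2006, Rmk 2.4.2 p.26] -/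
theorem Hom.exists_comm_castGe (b : X.graph.Branch) (v : X.graph.Vertex)
    (h : X.graph.abuts b = some v) :
    ∃ g : Y.Gv (F.base.vertexMap v), ∀ x : X.Ge (X.graph.edgeOf b),
      F.hV v (X.brHom b v h x) = g * Y.brHom (F.base.branchMap b) (F.base.vertexMap v)
        (F.base.abuts_branchMap b v h)
        (Y.castGe (F.base.edgeOf_branchMap b).symm (F.hE (X.graph.edgeOf b) x)) * g⁻¹ := by
  obtain ⟨g, hg⟩ := F.comm b v h
  refine ⟨g, fun x => ?_⟩
  rw [hg x, eqRec_eq_castGe (F.base.edgeOf_branchMap b)]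

/-- **The image of a branch group**: `hV_v(Π_b) = c · Π_{F b} · c⁻¹` for the 2-cell `c` of `F` at
`b`, when `hE` is surjective. [cite: MochizukiSemiAnbd2006, Rmk 2.4.2 p.26] -/
theorem Hom.exists_map_hV_branchSubgroup (hlt : F.IsLocallyTrivial) (b : X.graph.Branch)
    (v : X.graph.Vertex) (h : X.graph.abuts b = some v) :
    ∃ c : Y.Gv (F.base.vertexMap v),
      (X.branchSubgroup b v h).map (F.hV v).toMonoidHom =
        (Y.branchSubgroup (F.base.branchMap b) (F.base.vertexMap v) (F.base.abuts_branchMap b v h)).map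
          (MulAut.conj c).toMonoidHom := by
  obtain ⟨c, hc⟩ := F.exists_comm_castGe b v h
  refine ⟨c, ?_⟩
  ext z
  constructor
  · rintro ⟨_, ⟨x, rfl⟩, rfl⟩
    exact ⟨_, ⟨_, rfl⟩, (hc x).symm⟩
  · rintro ⟨_, ⟨y, rfl⟩, rfl⟩
    obtain ⟨x, hx⟩ := ((Y.castGe (F.base.edgeOf_branchMap b).symm).surjective.comp
      (hlt.2 (X.graph.edgeOf b)).2) y
    refine ⟨_, ⟨x, rfl⟩, ?_⟩
    change F.hV v (X.brHom b v h x) = _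
    rw [hc x, ← hx]
    rfl

/-! ### Injective type and verticial slimness descend -/

/-- **Injective type descends**: `hV ∘ b_* = conj_c ∘ (F b)_* ∘ castGe ∘ hE` with `(F b)_*`, `castGe`,
`hE` injective. [cite: MochizukiSemiAnbd2006, Def 2.1 p.22] -/
theorem isOfInjectiveType_of_iso (hlt : F.IsLocallyTrivial) (hY : Y.IsOfInjectiveType) :
    X.IsOfInjectiveType := by
  intro b v h x x' hxx'
  obtain ⟨c, hc⟩ := F.exists_comm_castGe b v h
  have h1 := congrArg (F.hV v) hxx'
  rw [hc x, hc x', mul_left_inj, mul_right_inj] at h1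
  exact (hlt.2 _).1 ((Y.castGe _).injective (hY _ _ _ h1))

/-- **Verticial slimness descends** (slimness is invariant under isomorphisms of topological groups).
[cite: MochizukiSemiAnbd2006, Def 2.4(ii) p.25] -/
theorem isVerticiallySlim_of_iso (hlt : F.IsLocallyTrivial) (hY : Y.IsVerticiallySlim) :
    X.IsVerticiallySlim := fun v => by
  obtain ⟨e, -⟩ := exists_continuousMulEquiv_of_bijective (F.hV v) (hlt.1 v)
  exact (Literature.AnabelianGeometry.AbsoluteAnabelian.isSlimGroup_congr e).2 (hY _)

/-! ### Aloofness and estrangement descend -/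

section AloofEstranged

/-- Pushing a conjugate forward: `f(g K g⁻¹) = f(g) f(K) f(g)⁻¹`. [folklore] -/
private theorem map_conj_map {A B : Type*} [Group A] [Group B] (f : A →* B) (K : Subgroup A) (a : A) :
    (K.map (MulAut.conj a).toMonoidHom).map f = (K.map f).map (MulAut.conj (f a)).toMonoidHom := by
  rw [Subgroup.map_map, Subgroup.map_map]
  congr 1
  ext x
  simp only [MonoidHom.coe_comp, Function.comp_apply, MulEquiv.coe_toMonoidHom, MulAut.conj_apply,
    map_mul, map_inv]

/-- Composing conjugations. [folklore] -/
private theorem map_conj_conj {A : Type*} [Group A] (K : Subgroup A) (a b : A) :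
    (K.map (MulAut.conj a).toMonoidHom).map (MulAut.conj b).toMonoidHom =
      K.map (MulAut.conj (b * a)).toMonoidHom := by
  rw [Subgroup.map_map]
  congr 1
  ext x
  simp only [MonoidHom.coe_comp, Function.comp_apply, MulEquiv.coe_toMonoidHom, MulAut.conj_apply]
  group

/-- Conjugation by `1`. [folklore] -/
private theorem map_conj_one {A : Type*} [Group A] (K : Subgroup A) :
    K.map (MulAut.conj (1 : A)).toMonoidHom = K := by
  ext x
  constructor
  · rintro ⟨y, hy, rfl⟩
    simp only [map_one, MulEquiv.coe_toMonoidHom, MulAut.one_apply]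
    exact hy
  · intro hx
    exact ⟨x, hx, by simp only [map_one, MulEquiv.coe_toMonoidHom, MulAut.one_apply]⟩

variable {F}

/-- **Aloofness, one pair of branches**: if on the `Y` side the `g₀`-conjugate of `Π_{F b'}` has
infinite index relative to `Π_{F b}`, `g₀ := c⁻¹ · hV(g) · c'` (`c`, `c'` the 2-cells), then on the `X`
side the `g`-conjugate of `Π_{b'}` has infinite index relative to `Π_b` — `hV` is injective.
[cite: MochizukiSemiAnbd2006, Def 2.4(iv) p.26] -/
theorem relIndex_map_conj_eq_zero_of_iso (hlt : F.IsLocallyTrivial) {b b' : X.graph.Branch}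
    {v : X.graph.Vertex} {h : X.graph.abuts b = some v} {h' : X.graph.abuts b' = some v}
    {c c' : Y.Gv (F.base.vertexMap v)}
    (hc : (X.branchSubgroup b v h).map (F.hV v).toMonoidHom =
      (Y.branchSubgroup (F.base.branchMap b) _ (F.base.abuts_branchMap b v h)).map
        (MulAut.conj c).toMonoidHom)
    (hc' : (X.branchSubgroup b' v h').map (F.hV v).toMonoidHom =
      (Y.branchSubgroup (F.base.branchMap b') _ (F.base.abuts_branchMap b' v h')).map
        (MulAut.conj c').toMonoidHom)
    (g : X.Gv v)
    (hY : ((Y.branchSubgroup (F.base.branchMap b') _ (F.base.abuts_branchMap b' v h')).map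
        (MulAut.conj (c⁻¹ * F.hV v g * c')).toMonoidHom).relIndex
      (Y.branchSubgroup (F.base.branchMap b) _ (F.base.abuts_branchMap b v h)) = 0) :
    ((X.branchSubgroup b' v h').map (MulAut.conj g).toMonoidHom).relIndex (X.branchSubgroup b v h) = 0 := by
  have hinj : Function.Injective ((F.hV v).toMonoidHom : X.Gv v →* Y.Gv (F.base.vertexMap v)) :=
    (hlt.1 v).1
  have hinj' : Function.Injective ((MulAut.conj c⁻¹).toMonoidHom :
      Y.Gv (F.base.vertexMap v) →* Y.Gv (F.base.vertexMap v)) := (MulAut.conj c⁻¹).injective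
  rw [← Subgroup.relIndex_map_map_of_injective _ _ hinj, map_conj_map, hc', hc,
    ← Subgroup.relIndex_map_map_of_injective _ _ hinj', map_conj_conj, map_conj_conj, map_conj_conj,
    inv_mul_cancel, map_conj_one]
  exact hY

/-- **Estrangement, one pair of branches**: trivial intersections pull back along the injective `hV`.
[cite: MochizukiSemiAnbd2006, Def 2.4(iv) p.26] -/
theorem inf_map_conj_eq_bot_of_iso (hlt : F.IsLocallyTrivial) {b b' : X.graph.Branch}
    {v : X.graph.Vertex} {h : X.graph.abuts b = some v} {h' : X.graph.abuts b' = some v}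
    {c c' : Y.Gv (F.base.vertexMap v)}
    (hc : (X.branchSubgroup b v h).map (F.hV v).toMonoidHom =
      (Y.branchSubgroup (F.base.branchMap b) _ (F.base.abuts_branchMap b v h)).map
        (MulAut.conj c).toMonoidHom)
    (hc' : (X.branchSubgroup b' v h').map (F.hV v).toMonoidHom =
      (Y.branchSubgroup (F.base.branchMap b') _ (F.base.abuts_branchMap b' v h')).map
        (MulAut.conj c').toMonoidHom)
    (g : X.Gv v)
    (hY : Y.branchSubgroup (F.base.branchMap b) _ (F.base.abuts_branchMap b v h) ⊓
      (Y.branchSubgroup (F.base.branchMap b') _ (F.base.abuts_branchMap b' v h')).map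
        (MulAut.conj (c⁻¹ * F.hV v g * c')).toMonoidHom = ⊥) :
    X.branchSubgroup b v h ⊓ (X.branchSubgroup b' v h').map (MulAut.conj g).toMonoidHom = ⊥ := by
  have hinj : Function.Injective ((F.hV v).toMonoidHom : X.Gv v →* Y.Gv (F.base.vertexMap v)) :=
    (hlt.1 v).1
  have hinj' : Function.Injective ((MulAut.conj c⁻¹).toMonoidHom :
      Y.Gv (F.base.vertexMap v) →* Y.Gv (F.base.vertexMap v)) := (MulAut.conj c⁻¹).injective
  apply Subgroup.map_injective hinj
  apply Subgroup.map_injective hinj'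
  rw [Subgroup.map_bot, Subgroup.map_bot, Subgroup.map_inf_eq _ _ _ hinj, Subgroup.map_inf_eq _ _ _ hinj',
    map_conj_map, hc', hc, map_conj_conj, map_conj_conj, map_conj_conj, inv_mul_cancel, map_conj_one]
  exact hY

/-- The side condition at equal branches: if `c⁻¹ · hV(g) · c ∈ Π_{F b}` then `g ∈ Π_b`.
[cite: MochizukiSemiAnbd2006, Def 2.4(iv) p.26] -/
theorem mem_branchSubgroup_of_conj_mem (hlt : F.IsLocallyTrivial) {b : X.graph.Branch}
    {v : X.graph.Vertex} {h : X.graph.abuts b = some v} {c : Y.Gv (F.base.vertexMap v)}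
    (hc : (X.branchSubgroup b v h).map (F.hV v).toMonoidHom =
      (Y.branchSubgroup (F.base.branchMap b) _ (F.base.abuts_branchMap b v h)).map
        (MulAut.conj c).toMonoidHom)
    {g : X.Gv v}
    (hg : c⁻¹ * F.hV v g * c ∈ Y.branchSubgroup (F.base.branchMap b) _ (F.base.abuts_branchMap b v h)) :
    g ∈ X.branchSubgroup b v h := by
  have h1 : F.hV v g ∈ (X.branchSubgroup b v h).map (F.hV v).toMonoidHom := by
    rw [hc]
    exact ⟨_, hg, by simp only [MulEquiv.coe_toMonoidHom, MulAut.conj_apply]; group⟩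
  obtain ⟨x, hx, hxg⟩ := h1
  rw [← (hlt.1 v).1 hxg]
  exact hx

variable [IsIso (C := SemiGraph.{u}) F.base]

/-- **Total aloofness descends along an isomorphism of presentations.**
[cite: MochizukiSemiAnbd2006, Def 2.4(iv) p.26] -/
theorem isTotallyAloof_of_iso (hlt : F.IsLocallyTrivial) (hY : Y.IsTotallyAloof) : X.IsTotallyAloof := by
  intro e b _ v h b' h' g hside
  obtain ⟨c, hc⟩ := F.exists_map_hV_branchSubgroup hlt b v h
  by_cases hbb : b' = b
  · subst hbb
    refine relIndex_map_conj_eq_zero_of_iso hlt hc hc g (hY _ _ rfl _ _ _ _ _ (Or.inr fun hg => ?_))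
    exact (hside.resolve_left fun hne => hne rfl) (mem_branchSubgroup_of_conj_mem hlt hc hg)
  · obtain ⟨c', hc'⟩ := F.exists_map_hV_branchSubgroup hlt b' v h'
    exact relIndex_map_conj_eq_zero_of_iso hlt hc hc' g (hY _ _ rfl _ _ _ _ _
      (Or.inl fun heq => hbb (SemiGraph.branchMap_injective_of_isIso F.base heq)))

/-- **Total estrangement descends along an isomorphism of presentations.**
[cite: MochizukiSemiAnbd2006, Def 2.4(iv) p.26] -/
theorem isTotallyEstranged_of_iso (hlt : F.IsLocallyTrivial) (hY : Y.IsTotallyEstranged) :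
    X.IsTotallyEstranged := by
  intro e
  refine ⟨isTotallyAloof_of_iso hlt (fun e' => (hY e').1) e, ?_⟩
  intro b _ v h b' h' g hside
  obtain ⟨c, hc⟩ := F.exists_map_hV_branchSubgroup hlt b v h
  by_cases hbb : b' = b
  · subst hbb
    refine inf_map_conj_eq_bot_of_iso hlt hc hc g ((hY _).2 _ rfl _ _ _ _ _ (Or.inr fun hg => ?_))
    exact (hside.resolve_left fun hne => hne rfl) (mem_branchSubgroup_of_conj_mem hlt hc hg)
  · obtain ⟨c', hc'⟩ := F.exists_map_hV_branchSubgroup hlt b' v h'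
    exact inf_map_conj_eq_bot_of_iso hlt hc hc' g ((hY _).2 _ rfl _ _ _ _ _
      (Or.inl fun heq => hbb (SemiGraph.branchMap_injective_of_isIso F.base heq)))

end AloofEstranged

end ProfiniteSemiGraph

end Literature.AnabelianGeometry.SemiGraphs
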